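/-
Copyright: rh-split cell (screw, prover seat l19) gen 0, 2026-08-27.  Splitting search over kernel-typed
RH-equivalences.  A splitting `A ∧ B ⟹ RH` is CONDITIONAL bookkeeping unless `A` and `B` are both
proved; nothing here bears on the truth of RH.
-/
import Summits.RiemannHypothesis.RiemannHypothesis.Theorems.Splittings.ScrewBorelFluxA
import Summits.RiemannHypothesis.RiemannHypothesis.Theorems.Splittings.ScrewLatticeContinuationA
import Mathlib.Analysis.Normed.Group.Tannery
import Mathlib.Analysis.SpecificLimits.Basic
import HarnessLib

/-!
# Route X-13 `ScrewLasso` — CHARGE CONTINUITY at `h → 0⁺` (item `ChargeContinuity`, RH-free)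

Objects of `ScrewLatticeContinuation` (row X-9): step `h > 0`, multipliers `u_ρ = e^{(ρ-1/2)h}`
(`mult`), coefficients `c_ρ = m(ρ)/(ρ-1/2)²` (`coeff`; `Re c_ρ < 0`, `∑ ‖c_ρ‖ < ∞`), and the disc charge
`discWeight c u p R` of `ScrewBorelFlux`.  The TOTAL ALIASED CHARGE at step `h` is
`Q(h) = ∑_ρ discWeight (c_ρ) (u_ρ) 0 1`: every zero LEFT of the critical line contributes `(c_ρ/2)·u_ρ`,
every zero RIGHT of it `(c_ρ/2)·u_ρ⁻¹`, and every zero ON the line nothing (§1, the indicator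
semantics; adapted — with attribution — from the referee probe `ProbeX13A_ref2.lean` §(D) of
rh-split-ref-2 g5, survivor census #29).

**Theorem** (`rh_of_chargeContinuity`).  If `Q(h) = 0` along steps `h → 0⁺` (for every `δ > 0` some
`h ∈ (0, δ)` has `Q(h) = 0`), then the Riemann hypothesis holds.  Proof: `u_ρ(h) → 1` (§2), so the
`ρ`-th charge tends to `𝟙[Re ρ ≠ 1/2]·c_ρ/2`, dominated by `‖c_ρ‖` (summable); Tannery's theorem
(`tendsto_tsum_of_dominated_convergence`) gives `∑_{ρ off-line} c_ρ/2 = 0`, whose real part is a sum of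
non-positive terms, strictly negative at each off-line zero (`re_coeff_neg`) — so there is none (§3).

The route decl `Theses.ScrewLasso.ChargeContinuity` is this statement verbatim (closing file
`ScrewLassoChargeContinuity`).  RH is not proved by this: `ChargeContinuity` is one RH-free leg of the
conditional splitting X-13 `LassoFlux ∧ ChargeContinuity ∧ LassoFine ∧ CeilAll ⟹ RH`.
No `sorry`, no new axioms, no instances, no notation.
-/

set_option linter.dupNamespace false

namespace Summit.RiemannHypothesis.RiemannHypothesis.Theorems.Splittings.ScrewLassoCharge

open Complex Filter Topology Set Metric
open Literature.NumberTheory.LFunctions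
open ZetaZeros.riemannZetaNontrivialZeros
open Summit.RiemannHypothesis.RiemannHypothesis.Theorems.Splittings
open Summit.RiemannHypothesis.RiemannHypothesis.Theorems.Splittings.ScrewBorel
open Summit.RiemannHypothesis.RiemannHypothesis.Theorems.Splittings.ScrewBorelFlux
open Summit.RiemannHypothesis.RiemannHypothesis.Theorems.Splittings.ScrewLatticeContinuation

/-! ## 1. Indicator semantics of the total charge (adapted from rh-split-ref-2 g5,
`ProbeX13A_ref2.lean` §(D), census #29 — kernel-checked there with std axioms) -/

/-- The charge of one term on the unit disc about `0`, unfolded. -/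
theorem discWeight_zero_one (c u : ℂ) :
    discWeight c u 0 1 =
      (if ‖u⁻¹‖ < 1 then c / 2 * u⁻¹ else 0) + (if ‖u‖ < 1 then c / 2 * u else 0) := by
  simp only [discWeight, sub_zero]

/-- `‖u_ρ‖ < 1 ↔ Re ρ < 1/2` (`h > 0`). -/
theorem norm_mult_lt_one_iff {h : ℝ} (hh : 0 < h) (ρ : ZetaZeros.riemannZetaNontrivialZeros) :
    ‖mult h ρ‖ < 1 ↔ (ρ : ℂ).re < 1 / 2 := by
  rw [norm_mult, Real.exp_lt_one_iff]
  refine ⟨fun H ↦ ?_, fun H ↦ mul_neg_of_neg_of_pos (by linarith) hh⟩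
  by_contra H'
  push Not at H'
  nlinarith [mul_nonneg (sub_nonneg.2 H') hh.le]

/-- `‖u_ρ⁻¹‖ < 1 ↔ 1/2 < Re ρ` (`h > 0`). -/
theorem norm_mult_inv_lt_one_iff {h : ℝ} (hh : 0 < h) (ρ : ZetaZeros.riemannZetaNontrivialZeros) :
    ‖(mult h ρ)⁻¹‖ < 1 ↔ 1 / 2 < (ρ : ℂ).re := by
  rw [norm_inv, norm_mult, ← Real.exp_neg, Real.exp_lt_one_iff, neg_lt_zero]
  refine ⟨fun H ↦ ?_, fun H ↦ mul_pos (by linarith) hh⟩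
  by_contra H'
  push Not at H'
  nlinarith [mul_nonneg (sub_nonneg.2 H') hh.le]

/-- On-line zeros contribute nothing to the total charge at any step `h > 0`. -/
theorem discWeight_eq_zero_of_re_eq_half {h : ℝ} (hh : 0 < h) (c : ℂ)
    (ρ : ZetaZeros.riemannZetaNontrivialZeros) (hρ : (ρ : ℂ).re = 1 / 2) :
    discWeight c (mult h ρ) 0 1 = 0 := by
  have h1 : ¬ ‖mult h ρ‖ < 1 := by rw [norm_mult_lt_one_iff hh]; linarith
  have h2 : ¬ ‖(mult h ρ)⁻¹‖ < 1 := by rw [norm_mult_inv_lt_one_iff hh]; linarith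
  rw [discWeight_zero_one, if_neg h2, if_neg h1, add_zero]

/-- A zero LEFT of the line carries charge `(c/2)·u_ρ` (pole `u_ρ` inside the disc). -/
theorem discWeight_of_re_lt_half {h : ℝ} (hh : 0 < h) (c : ℂ)
    (ρ : ZetaZeros.riemannZetaNontrivialZeros) (hρ : (ρ : ℂ).re < 1 / 2) :
    discWeight c (mult h ρ) 0 1 = c / 2 * mult h ρ := by
  have h1 : ‖mult h ρ‖ < 1 := (norm_mult_lt_one_iff hh ρ).2 hρ
  have h2 : ¬ ‖(mult h ρ)⁻¹‖ < 1 := by rw [norm_mult_inv_lt_one_iff hh]; linarith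
  rw [discWeight_zero_one, if_neg h2, if_pos h1, zero_add]

/-- A zero RIGHT of the line carries charge `(c/2)·u_ρ⁻¹` (pole `u_ρ⁻¹` inside the disc). -/
theorem discWeight_of_half_lt_re {h : ℝ} (hh : 0 < h) (c : ℂ)
    (ρ : ZetaZeros.riemannZetaNontrivialZeros) (hρ : 1 / 2 < (ρ : ℂ).re) :
    discWeight c (mult h ρ) 0 1 = c / 2 * (mult h ρ)⁻¹ := by
  have h1 : ¬ ‖mult h ρ‖ < 1 := by rw [norm_mult_lt_one_iff hh]; linarith
  have h2 : ‖(mult h ρ)⁻¹‖ < 1 := (norm_mult_inv_lt_one_iff hh ρ).2 hρ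
  rw [discWeight_zero_one, if_pos h2, if_neg h1, add_zero]

/-- Uniform domination for the Tannery step: `‖charge of ρ at step h‖ ≤ ‖c_ρ‖` for every `h > 0`. -/
theorem norm_discWeight_le {h : ℝ} (hh : 0 < h) (c : ℂ) (ρ : ZetaZeros.riemannZetaNontrivialZeros) :
    ‖discWeight c (mult h ρ) 0 1‖ ≤ ‖c‖ := by
  rcases lt_trichotomy ((ρ : ℂ).re) (1 / 2) with hlt | heq | hgt
  · rw [discWeight_of_re_lt_half hh c ρ hlt, norm_mul, norm_div, Complex.norm_ofNat]
    have := (norm_mult_lt_one_iff hh ρ).2 hlt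
    nlinarith [norm_nonneg c, norm_nonneg (mult h ρ)]
  · rw [discWeight_eq_zero_of_re_eq_half hh c ρ heq, norm_zero]; exact norm_nonneg _
  · rw [discWeight_of_half_lt_re hh c ρ hgt, norm_mul, norm_div, Complex.norm_ofNat]
    have := (norm_mult_inv_lt_one_iff hh ρ).2 hgt
    nlinarith [norm_nonneg c, norm_nonneg (mult h ρ)⁻¹]

/-! ## 2. The limit `h → 0⁺`: `u_ρ(h) → 1`, termwise limits, Tannery -/

/-- `u_ρ(h_n) → 1` along any real sequence `h_n → 0`. -/
theorem tendsto_mult_one (ρ : ZetaZeros.riemannZetaNontrivialZeros) {s : ℕ → ℝ}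
    (hs : Tendsto s atTop (𝓝 0)) : Tendsto (fun n ↦ mult (s n) ρ) atTop (𝓝 1) := by
  have h1 : Tendsto (fun n ↦ ((ρ : ℂ) - 1 / 2) * ((s n : ℝ) : ℂ)) atTop
      (𝓝 (((ρ : ℂ) - 1 / 2) * (((0 : ℝ) : ℝ) : ℂ))) :=
    tendsto_const_nhds.mul ((Complex.continuous_ofReal.tendsto 0).comp hs)
  rw [Complex.ofReal_zero, mul_zero] at h1
  have h2 := (Complex.continuous_exp.tendsto _).comp h1
  rw [Complex.exp_zero] at h2
  exact h2

/-- Termwise limit of the charge of `ρ` as `h_n → 0⁺`: `𝟙[Re ρ ≠ 1/2]·c_ρ/2`. -/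
theorem tendsto_discWeight (ρ : ZetaZeros.riemannZetaNontrivialZeros) {s : ℕ → ℝ}
    (hs0 : ∀ n, 0 < s n) (hs : Tendsto s atTop (𝓝 0)) :
    Tendsto (fun n ↦ discWeight (coeff ρ) (mult (s n) ρ) 0 1) atTop
      (𝓝 (if (ρ : ℂ).re = 1 / 2 then (0 : ℂ) else coeff ρ / 2)) := by
  rcases lt_trichotomy ((ρ : ℂ).re) (1 / 2) with hlt | heq | hgt
  · rw [if_neg hlt.ne]
    have e : (fun n ↦ discWeight (coeff ρ) (mult (s n) ρ) 0 1) =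
        fun n ↦ coeff ρ / 2 * mult (s n) ρ :=
      funext fun n ↦ discWeight_of_re_lt_half (hs0 n) _ ρ hlt
    rw [e]
    have := (tendsto_mult_one ρ hs).const_mul (coeff ρ / 2)
    rwa [mul_one] at this
  · rw [if_pos heq]
    have e : (fun n ↦ discWeight (coeff ρ) (mult (s n) ρ) 0 1) = fun _ ↦ (0 : ℂ) :=
      funext fun n ↦ discWeight_eq_zero_of_re_eq_half (hs0 n) _ ρ heq
    rw [e]
    exact tendsto_const_nhds
  · rw [if_neg hgt.ne']
    have e : (fun n ↦ discWeight (coeff ρ) (mult (s n) ρ) 0 1) =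
        fun n ↦ coeff ρ / 2 * (mult (s n) ρ)⁻¹ :=
      funext fun n ↦ discWeight_of_half_lt_re (hs0 n) _ ρ hgt
    rw [e]
    have := ((tendsto_mult_one ρ hs).inv₀ one_ne_zero).const_mul (coeff ρ / 2)
    rwa [inv_one, mul_one] at this

/-- **Tannery step.**  Along steps `h_n → 0⁺` the total charge tends to `∑_ρ 𝟙[Re ρ ≠ 1/2]·c_ρ/2`
(domination by `‖c_ρ‖`, `summable_norm_coeff`). -/
theorem tendsto_tsum_discWeight {s : ℕ → ℝ} (hs0 : ∀ n, 0 < s n) (hs : Tendsto s atTop (𝓝 0)) :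
    Tendsto (fun n ↦ ∑' ρ : ZetaZeros.riemannZetaNontrivialZeros,
        discWeight (coeff ρ) (mult (s n) ρ) 0 1) atTop
      (𝓝 (∑' ρ : ZetaZeros.riemannZetaNontrivialZeros,
        if (ρ : ℂ).re = 1 / 2 then (0 : ℂ) else coeff ρ / 2)) :=
  tendsto_tsum_of_dominated_convergence
    (f := fun n (ρ : ZetaZeros.riemannZetaNontrivialZeros) ↦ discWeight (coeff ρ) (mult (s n) ρ) 0 1)
    (bound := fun ρ ↦ ‖coeff ρ‖) summable_norm_coeff (fun ρ ↦ tendsto_discWeight ρ hs0 hs)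
    (Eventually.of_forall fun n ρ ↦ norm_discWeight_le (hs0 n) _ ρ)

/-! ## 3. Sign: the off-line charges cannot sum to zero unless there are none -/

/-- **Sign step.**  If `∑_ρ 𝟙[Re ρ ≠ 1/2]·c_ρ/2 = 0` then every non-trivial zero is on the critical line
(each term has real part `≤ 0`, and `< 0` exactly at the off-line zeros, `re_coeff_neg`). -/
theorem re_eq_half_of_tsum_eq_zero
    (h0 : ∑' ρ : ZetaZeros.riemannZetaNontrivialZeros,
      (if (ρ : ℂ).re = 1 / 2 then (0 : ℂ) else coeff ρ / 2) = 0)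
    (ρ : ZetaZeros.riemannZetaNontrivialZeros) : (ρ : ℂ).re = 1 / 2 := by
  by_contra hne
  set g : ZetaZeros.riemannZetaNontrivialZeros → ℂ :=
    fun ρ ↦ if (ρ : ℂ).re = 1 / 2 then (0 : ℂ) else coeff ρ / 2 with hg
  have hgb : ∀ ρ' : ZetaZeros.riemannZetaNontrivialZeros, ‖g ρ'‖ ≤ ‖coeff ρ'‖ := by
    intro ρ'
    simp only [hg]
    split_ifs
    · rw [norm_zero]; exact norm_nonneg _
    · rw [norm_div, Complex.norm_ofNat]
      linarith [norm_nonneg (coeff ρ')]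
  have hgs : Summable g := Summable.of_norm_bounded summable_norm_coeff hgb
  have hre_sum : Summable fun ρ' ↦ (g ρ').re := (Complex.hasSum_re hgs.hasSum).summable
  have hnonpos : ∀ ρ' : ZetaZeros.riemannZetaNontrivialZeros, (g ρ').re ≤ 0 := by
    intro ρ'
    simp only [hg]
    split_ifs
    · simp
    · rw [Complex.div_ofNat_re]
      have := re_coeff_neg ρ'
      linarith
  have hneg : (g ρ).re < 0 := by
    simp only [hg]
    rw [if_neg hne, Complex.div_ofNat_re]
    have := re_coeff_neg ρ
    linarith
  have hlt : ∑' ρ', (g ρ').re < ∑' _ : ZetaZeros.riemannZetaNontrivialZeros, (0 : ℝ) :=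
    hre_sum.tsum_lt_tsum hnonpos hneg summable_zero
  rw [tsum_zero, ← Complex.re_tsum hgs] at hlt
  have hg0 : ∑' ρ', g ρ' = 0 := h0
  rw [hg0, Complex.zero_re] at hlt
  exact lt_irrefl _ hlt

/-- **CHARGE CONTINUITY (RH-free).**  If for every `δ > 0` some step `h ∈ (0, δ)` has vanishing total
aliased charge `∑_ρ discWeight (c_ρ) (u_ρ) 0 1 = 0`, then the Riemann hypothesis holds. -/
theorem rh_of_chargeContinuity
    (hyp : ∀ δ : ℝ, 0 < δ → ∃ h ∈ Set.Ioo 0 δ,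
      ∑' ρ : ZetaZeros.riemannZetaNontrivialZeros, discWeight (coeff ρ) (mult h ρ) 0 1 = 0) :
    _root_.RiemannHypothesis := by
  -- a sequence of steps `s n ∈ (0, 1/(n+1))` with vanishing total charge
  choose s hs hzero using fun n : ℕ ↦ hyp (1 / ((n : ℝ) + 1)) (by positivity)
  have hs0 : ∀ n, 0 < s n := fun n ↦ (hs n).1
  have hslim : Tendsto s atTop (𝓝 0) :=
    squeeze_zero (fun n ↦ (hs0 n).le) (fun n ↦ (hs n).2.le)
      (tendsto_one_div_add_atTop_nhds_zero_nat (𝕜 := ℝ))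
  -- Tannery: the (identically zero) total charges converge to the off-line charge sum
  have hlim := tendsto_tsum_discWeight hs0 hslim
  have hconst : (fun n ↦ ∑' ρ : ZetaZeros.riemannZetaNontrivialZeros,
      discWeight (coeff ρ) (mult (s n) ρ) 0 1) = fun _ ↦ (0 : ℂ) := funext hzero
  rw [hconst] at hlim
  have h0 := tendsto_nhds_unique hlim tendsto_const_nhds
  -- sign: every zero is on the line
  have hline := re_eq_half_of_tsum_eq_zero h0
  refine quasiRiemannHypothesis_one_half_iff_holds.1 fun z hζ hσ hσ1 ↦ ?_
  have hz : z ∈ ZetaZeros.riemannZetaNontrivialZeros := mem_of_re_pos hζ (by linarith)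
  have := hline ⟨z, hz⟩
  simp only at this
  linarith

end Summit.RiemannHypothesis.RiemannHypothesis.Theorems.Splittings.ScrewLassoCharge
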